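import Mathlib
import Summits.Ventures.HodgeRepro2.T5PrincipalUnitFiltration

/-!
# The conductor of a product `χ₁ χ₂` when `χ₁` is trivial below the exact level of `χ₂`

Lemma N5.L4(iv-c): «`a(ω̃ β_{2k}) = 2k`: `ω̃ β_{2k}` is trivial on `U_E^{2k}` and non-trivial on
`U_E^{2k−1}`, since `ω̃|_{U_E^{2k−1}} = 1` for `2k − 1 ≥ 2t + 1` while `β_{2k}|_{U_E^{2k−1}} ≠ 1`; and
`ω̃ β_{2k}` is conjugate-symplectic by (A2)» — as group theory:

* `mul_eq_one_on_of_eq_one_on`: trivial on `H` × trivial on `H` = trivial on `H`;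
* `mul_ne_one_on_of_eq_one_on`: `χ₁` trivial on `H'`, `χ₂` NOT trivial on `H'` ⇒ `χ₁ χ₂` not trivial
  on `H'`;
* `exact_level_mul` (in the `higherUnits` language): `χ₁` trivial on `U^m`, `χ₂` trivial on `U^n`
  and non-trivial on `U^{n−1}`, `m ≤ n − 1` ⇒ `χ₁ χ₂` trivial on `U^n`, non-trivial on `U^{n−1}`;
* `restrict_mul_eq_of_eq_one_on`: `χ₁|_A = μ|_A`, `χ₂|_A = 1` ⇒ `(χ₁ χ₂)|_A = μ|_A` (the
  «conjugate-symplectic × conjugate-orthogonal = conjugate-symplectic» clause (A2)).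

Declaration per README §8(d): «uses an L-value-free non-vanishing device: NO».
-/

namespace Summit.Ventures.HodgeRepro2.T5ProductConductor

open T5PrincipalUnitFiltration

section Group

variable {G M : Type*} [Group G] [CommMonoid M]

/-- Trivial on `H` is closed under products. -/
theorem mul_eq_one_on_of_eq_one_on {χ₁ χ₂ : G →* M} {H : Subgroup G}
    (h₁ : ∀ x ∈ H, χ₁ x = 1) (h₂ : ∀ x ∈ H, χ₂ x = 1) : ∀ x ∈ H, (χ₁ * χ₂) x = 1 := by
  intro x hx
  rw [MonoidHom.mul_apply, h₁ x hx, h₂ x hx, mul_one]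

/-- `χ₁` trivial on `H'`, `χ₂` not trivial on `H'` ⇒ `χ₁ χ₂` not trivial on `H'`. -/
theorem mul_ne_one_on_of_eq_one_on {χ₁ χ₂ : G →* M} {H' : Subgroup G}
    (h₁ : ∀ x ∈ H', χ₁ x = 1) (h₂ : ¬ ∀ x ∈ H', χ₂ x = 1) : ¬ ∀ x ∈ H', (χ₁ * χ₂) x = 1 := by
  intro h
  apply h₂
  intro x hx
  have := h x hx
  rwa [MonoidHom.mul_apply, h₁ x hx, one_mul] at this

/-- `χ₁|_A = μ|_A` and `χ₂|_A = 1` ⇒ `(χ₁ χ₂)|_A = μ|_A`. -/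
theorem restrict_mul_eq_of_eq_one_on {χ₁ χ₂ μ : G →* M} {A : Subgroup G}
    (h₁ : ∀ x ∈ A, χ₁ x = μ x) (h₂ : ∀ x ∈ A, χ₂ x = 1) : ∀ x ∈ A, (χ₁ * χ₂) x = μ x := by
  intro x hx
  rw [MonoidHom.mul_apply, h₁ x hx, h₂ x hx, mul_one]

end Group

section Filtration

variable {R M : Type*} [CommRing R] [CommMonoid M] (ϖ : R)

/-- Lemma N5.L4(iv-c), the conductor of `ω̃ β_{2k}`: `χ₁` trivial on `U^m`, `χ₂` trivial on `U^n` and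
non-trivial on `U^{n−1}`, `m ≤ n − 1` ⇒ `χ₁ χ₂` trivial on `U^n` and non-trivial on `U^{n−1}`. -/
theorem exact_level_mul {χ₁ χ₂ : Rˣ →* M} {m n : ℕ} (hmn : m ≤ n - 1)
    (h₁ : ∀ x ∈ higherUnits ϖ m, χ₁ x = 1) (h₂ : ∀ x ∈ higherUnits ϖ n, χ₂ x = 1)
    (h₂' : ¬ ∀ x ∈ higherUnits ϖ (n - 1), χ₂ x = 1) :
    (∀ x ∈ higherUnits ϖ n, (χ₁ * χ₂) x = 1) ∧ ¬ ∀ x ∈ higherUnits ϖ (n - 1), (χ₁ * χ₂) x = 1 := by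
  have h₁' : ∀ x ∈ higherUnits ϖ (n - 1), χ₁ x = 1 := fun x hx =>
    h₁ x (higherUnits_antitone ϖ hmn hx)
  have h₁'' : ∀ x ∈ higherUnits ϖ n, χ₁ x = 1 := fun x hx =>
    h₁ x (higherUnits_antitone ϖ (le_trans hmn (Nat.sub_le n 1)) hx)
  exact ⟨mul_eq_one_on_of_eq_one_on h₁'' h₂, mul_ne_one_on_of_eq_one_on h₁' h₂'⟩

end Filtration

end Summit.Ventures.HodgeRepro2.T5ProductConductor
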